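import Summits.QuantumFields.BalabanUV.Beta.FP.TowerDoorDefectDefs
import Summits.QuantumFields.BalabanUV.Beta.SymTablesAn1S2Weighted

/-!
# `BalabanUV.Beta.FP.TowerDoorDefectCovariance` — binder row D1, the row's ONE file, the `ω`-EXHIBITION, part 3 (J-NOTE-21 §7 (B), the covariance): **THE WARD-DEFECT KERNEL IS JOINTLY
# BLOCK-COVARIANT — `defKerZ L tabs κ₂ (v ∘ (· − L•t)) (β.1 + t, β.2) = shiftK (−L•t) (defKerZ L tabs κ₂ v β)` — HENCE ITS TADPOLE AGAINST AN `L`-BLOCK INVARIANT CHART IS INVARIANT, AND THE DOOR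
# FUNCTIONAL's WEIGHT IS COVARIANT: `tadpole A (defKerZ … (Pi.single (u + L•y) 1) (y, κ)) = tadpole A (defKerZ … (Pi.single u 1) (0, κ))`** — the shape `ω_{(y,κ)} = ω_{(0,κ)}(· − L•y)` that
# PART 61's `hτ`∕`hΘ` letters consume (from the table record's own covariance fields `hmixt`∕`hHt`, `shiftK` bookkeeping, lit `tadpole_shiftK`)
# (β-function cell `pub-balaban`, BINDER-OWNERS row D1 ∕ (C1) OWNER «beta-an2» gen 77, PART 68; imports PART 62 + the row's `SymTablesAn1S2Weighted` (`shiftK_smul`))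

WHAT ([folklore] `shiftK` bookkeeping + one `tsum` re-indexing BY NAME; no `def`, no `def … : Prop`, nothing cited, 0 sorry, default heartbeats).
§1 `sgnK_shiftK` (`rfl`), **`M2Z_translate`** (`M2Z L tabs (u + L•t, κ) (β.1 + t, β.2) = shiftK (−L•t) (M2Z L tabs (u,κ) β)` — `tabs.hmixt`), `H_translate` (`tabs.hHt`), **`defKerZ_translate`** (the joint covariance above;
the gradient series re-indexed by `Equiv.addRight (L•t)`).
§2 **`tadpole_defKerZ_translate`** (for `∀ t, shiftK (−L•t) A = A`: `tadpole A (defKerZ … (v ∘ (· − L•t)) (β.1 + t, β.2)) = tadpole A (defKerZ … v β)` — lit `tadpole_shiftK`), **`tadpole_defKerZ_single_translate`**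
(`tadpole A (defKerZ … (Pi.single (u + L•y) 1) (y, κ)) = tadpole A (defKerZ … (Pi.single u 1) (0, κ))`), `tadpole_defKerZ_single_covariant` (the same read as `ω_{(y,κ)}(u) = ω_{(0,κ)}(u − L•y)`).
WHAT THIS IS NOT: not the record instance, not (T2); nothing of Bałaban's asserted, valued or discharged; 0 estimates; 0∕4 row-D1 binders (hW, hR, D1Tel, D1Rep); NOT (C1), NOT D1, NEVER «G-an2-4 closed», NOT BetaPertH,
NOT continuum, NOT Clay.

HONEST DEPENDENCY (page 1, mandatory): continuum YM on T⁴ ⇐ BetaPertH ∧ nine spine estimates (0/9 proved); BetaPertH ⇐ (D1) ∧ (D4) ∧ CAP+tail;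
G-an2-4 gates asym, D1 and NE2/3/4.  HONEST FRAMING (cell contract, verbatim): «discharging `BetaPertH` makes Bałaban's UV stability UNCONDITIONAL —
a real constructive-QFT result; it is NOT the continuum limit and NOT the Clay problem.»  ABSOLUTE RULE (cell charter, verbatim): «No internally-minted
statement may enter as a cited fact. Every hypothesis is either kernel-proved in this package or a verbatim quotation of a PUBLISHED theorem with page
reference. The manuscript(s) under audit are NOT citable for their own disputed steps — they are the thing under adjudication; programme-internal
(2001/route/tribunal) claims are never citable.»  Row D1 ∕ (C1) OWNER «beta-an2» gen 77, 2026-08-29.  No existing file touched.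
-/

noncomputable section

open Finset
open scoped BigOperators
open Literature.MathematicalPhysics.QuantumFieldTheory
open Literature.MathematicalPhysics.QuantumFieldTheory.Balaban1983to89
open Literature.MathematicalPhysics.QuantumFieldTheory.Balaban1983to89.Beta
open AffineAveraging (Site unitVec)
open OneStepResolventKernel (Fib)
open ExpKernelCalculus (MKer shiftK tadpole tadpole_shiftK)
open BalabanStepW2 (M2Of)
open Summit.QuantumFields.BalabanUV.Beta.SymmetrisedStepJets (SymTables)
open Summit.QuantumFields.BalabanUV.Beta.BorderedHessian (sgnF sgnK sgnK_apply)
open Summit.QuantumFields.BalabanUV.Beta.TameKernelCalculus (trK trK_apply)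
open Summit.QuantumFields.BalabanUV.Beta.SymTablesAn1S2Weighted (shiftK_smul)
open Summit.QuantumFields.BalabanUV.Beta.FP.TowerDoorDefectDefs

namespace Summit.QuantumFields.BalabanUV.Beta.FP.TowerDoorDefectCovariance

variable (L : ℕ) (tabs : SymTables 3 L) (κ₂ : ℝ)

/-! ## §1 Joint block covariance of the symmetrised mixed table, the Hessian table and the defect kernel -/

/-- [folklore] `sgnK` commutes with `shiftK` (`rfl`). -/
theorem sgnK_shiftK {d : ℕ} (s : Site (d + 1)) (K : MKer (d + 1) (Fib d)) : sgnK (shiftK s K) = shiftK s (sgnK K) := rfl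

/-- [folklore] **`M2Z_translate`** — the symmetrised mixed table is jointly block covariant: moving the fine bond by `L•t` and the coarse source by `t` is the shift by `−L•t` (the record's `hmixt`). -/
theorem M2Z_translate (u t : Site (3 + 1)) (κ : Fin (3 + 1)) (β : Site (3 + 1) × Fin (3 + 1)) :
    M2Z L tabs (u + ((L : ℕ) : ℤ) • t, κ) (β.1 + t, β.2) = shiftK (-(((L : ℕ) : ℤ) • t)) (M2Z L tabs (u, κ) β) := by
  rw [M2Z_eq, M2Z_eq]
  have h : M2Of 3 L tabs.mixFF 0 κ (u + ((L : ℕ) : ℤ) • t) β.2 (β.1 + t) = shiftK (-(((L : ℕ) : ℤ) • t)) (M2Of 3 L tabs.mixFF 0 κ u β.2 β.1) := by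
    show BalabanStepW2.wM2 3 L 0 • tabs.mixFF κ (u + ((L : ℕ) : ℤ) • t) β.2 (β.1 + t) = shiftK (-(((L : ℕ) : ℤ) • t)) (BalabanStepW2.wM2 3 L 0 • tabs.mixFF κ u β.2 β.1)
    rw [tabs.hmixt κ u β.2 β.1 t, shiftK_smul]
  rw [h]
  funext x w a b
  rfl

/-- [folklore] the Hessian table's covariance (the record's `hHt`), at a window. -/
theorem H_translate (t : Site (3 + 1)) (β : Site (3 + 1) × Fin (3 + 1)) :
    tabs.H β.2 (β.1 + t) = shiftK (-(((L : ℕ) : ℤ) • t)) (tabs.H β.2 β.1) := tabs.hHt β.2 β.1 t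

/-- [folklore] **`defKerZ_translate` — THE WARD-DEFECT KERNEL IS JOINTLY BLOCK COVARIANT**: translating the gauge function by `L•t` and the window by `t` is the shift by `−L•t`:
`defKerZ L tabs κ₂ (fun u => v (u − L•t)) (β.1 + t, β.2) = shiftK (−L•t) (defKerZ L tabs κ₂ v β)` (the gradient series re-indexed by `u ↦ u + L•t`). -/
theorem defKerZ_translate (v : Site (3 + 1) → ℝ) (t : Site (3 + 1)) (β : Site (3 + 1) × Fin (3 + 1)) :
    defKerZ L tabs κ₂ (fun u => v (u - ((L : ℕ) : ℤ) • t)) (β.1 + t, β.2) = shiftK (-(((L : ℕ) : ℤ) • t)) (defKerZ L tabs κ₂ v β) := by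
  funext x w a b
  rcases a with α | m
  · rcases b with α' | m'
    · show defKerZ L tabs κ₂ (fun u => v (u - ((L : ℕ) : ℤ) • t)) (β.1 + t, β.2) x w (Sum.inl α) (Sum.inl α')
        = defKerZ L tabs κ₂ v β (x + -(((L : ℕ) : ℤ) • t)) (w + -(((L : ℕ) : ℤ) • t)) (Sum.inl α) (Sum.inl α')
      rw [defKerZ_apply_inl_inl, defKerZ_apply_inl_inl]
      have hH : ∀ (x' w' : Site (3 + 1)), tabs.H β.2 (β.1 + t) x' w' (Sum.inl α) (Sum.inl α')
          = tabs.H β.2 β.1 (x' + -(((L : ℕ) : ℤ) • t)) (w' + -(((L : ℕ) : ℤ) • t)) (Sum.inl α) (Sum.inl α') := by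
        intro x' w'; rw [H_translate L tabs t β]; rfl
      have hgrad : ∀ κ : Fin (3 + 1),
          (∑' u : Site (3 + 1), (v (u + unitVec κ - ((L : ℕ) : ℤ) • t) - v (u - ((L : ℕ) : ℤ) • t)) * M2Z L tabs (u, κ) (β.1 + t, β.2) x w (Sum.inl α) (Sum.inl α'))
            = ∑' u : Site (3 + 1), (v (u + unitVec κ) - v u) * M2Z L tabs (u, κ) β (x + -(((L : ℕ) : ℤ) • t)) (w + -(((L : ℕ) : ℤ) • t)) (Sum.inl α) (Sum.inl α') := by
        intro κ
        rw [← (Equiv.addRight (((L : ℕ) : ℤ) • t)).tsum_eq (fun u : Site (3 + 1) =>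
          (v (u + unitVec κ - ((L : ℕ) : ℤ) • t) - v (u - ((L : ℕ) : ℤ) • t)) * M2Z L tabs (u, κ) (β.1 + t, β.2) x w (Sum.inl α) (Sum.inl α'))]
        refine tsum_congr fun u => ?_
        simp only [Equiv.coe_addRight]
        rw [M2Z_translate L tabs u t κ β]
        simp only [shiftK, add_sub_cancel_right]
        congr 2
        abel_nf
      simp only []
      rw [Finset.sum_congr rfl fun κ _ => hgrad κ, hH x w]
      simp only [sub_eq_add_neg]
    · rfl
  · rfl

/-! ## §2 The tadpole against a block-invariant chart; the covariance of the door functional's weight -/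

/-- [folklore] **`tadpole_defKerZ_translate`** — for an `L`-block invariant chart (`∀ t, shiftK (−L•t) A = A`):
`tadpole A (defKerZ … (fun u => v (u − L•t)) (β.1 + t, β.2)) = tadpole A (defKerZ … v β)` (covariance + lit `tadpole_shiftK`). -/
theorem tadpole_defKerZ_translate {A : MKer (3 + 1) (Fib 3)} (hA : ∀ t : Site (3 + 1), shiftK (-(((L : ℕ) : ℤ) • t)) A = A)
    (v : Site (3 + 1) → ℝ) (t : Site (3 + 1)) (β : Site (3 + 1) × Fin (3 + 1)) :
    tadpole A (defKerZ L tabs κ₂ (fun u => v (u - ((L : ℕ) : ℤ) • t)) (β.1 + t, β.2)) = tadpole A (defKerZ L tabs κ₂ v β) := by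
  rw [defKerZ_translate]
  conv_lhs => rw [← hA t]
  exact tadpole_shiftK _ _ _

/-- [folklore] **`tadpole_defKerZ_single_translate` — THE DOOR FUNCTIONAL's WEIGHT IS COVARIANT**: `tadpole A (defKerZ … (Pi.single (u + L•y) 1) (y, κ)) = tadpole A (defKerZ … (Pi.single u 1) (0, κ))`. -/
theorem tadpole_defKerZ_single_translate {A : MKer (3 + 1) (Fib 3)} (hA : ∀ t : Site (3 + 1), shiftK (-(((L : ℕ) : ℤ) • t)) A = A)
    (u y : Site (3 + 1)) (κ : Fin (3 + 1)) :
    tadpole A (defKerZ L tabs κ₂ (Pi.single (u + ((L : ℕ) : ℤ) • y) (1 : ℝ)) (y, κ))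
      = tadpole A (defKerZ L tabs κ₂ (Pi.single u (1 : ℝ)) ((0 : Site (3 + 1)), κ)) := by
  have e : (Pi.single (u + ((L : ℕ) : ℤ) • y) (1 : ℝ) : Site (3 + 1) → ℝ) = fun u' => (Pi.single u (1 : ℝ) : Site (3 + 1) → ℝ) (u' - ((L : ℕ) : ℤ) • y) := by
    funext u'
    by_cases h : u' = u + ((L : ℕ) : ℤ) • y
    · subst h; simp
    · rw [Pi.single_eq_of_ne h, Pi.single_eq_of_ne]
      intro h'; exact h (by rw [← h', sub_add_cancel])
  have h := tadpole_defKerZ_translate L tabs κ₂ hA (Pi.single u (1 : ℝ)) y ((0 : Site (3 + 1)), κ)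
  simp only [zero_add] at h
  rw [e]
  exact h

/-- [folklore] **`tadpole_defKerZ_single_covariant`** — the same read as `ω_{(y,κ)}(u) = ω_{(0,κ)}(u − L•y)`, the covariant weight shape of PART 61's `hτ`∕`hΘ` letters. -/
theorem tadpole_defKerZ_single_covariant {A : MKer (3 + 1) (Fib 3)} (hA : ∀ t : Site (3 + 1), shiftK (-(((L : ℕ) : ℤ) • t)) A = A)
    (u y : Site (3 + 1)) (κ : Fin (3 + 1)) :
    tadpole A (defKerZ L tabs κ₂ (Pi.single u (1 : ℝ)) (y, κ))
      = tadpole A (defKerZ L tabs κ₂ (Pi.single (u - ((L : ℕ) : ℤ) • y) (1 : ℝ)) ((0 : Site (3 + 1)), κ)) := by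
  have h := tadpole_defKerZ_single_translate L tabs κ₂ hA (u - ((L : ℕ) : ℤ) • y) y κ
  rw [sub_add_cancel] at h
  exact h

end Summit.QuantumFields.BalabanUV.Beta.FP.TowerDoorDefectCovariance

end
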